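import Mathlib
import HarnessLib
import Summits.HubbardSuperconductivity.HubbardSuperconductivity.Theorems.KLProgrammeKLRegimeSplitEdgeFactsRungJetsTransport
import Summits.HubbardSuperconductivity.HubbardSuperconductivity.Theorems.KLProgrammeKLRegimeSplitEdgeFactsRungJetsV
import Summits.HubbardSuperconductivity.HubbardSuperconductivity.Theorems.KLProgrammeKLRegimeSplitEdgeFactsTransferLines

/-!
# Route `KLProgramme` — edge facts for the pair masses ACROSS TRANSFERS, VII′: TRANSPORT of the composed jet rows from CENTRE data (row 22 `…RungJetsTransport`)
# with ABSTRACT band-jet constants `(v, κ)` — `klrtv_norm_propCT_three_le`, `klrtv_abs_nambuXiCT_three_le`, `klrtv_norm_*_secondDiff_le_centre`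

Cell gate-hubbard-kl, seat hubbard-kl-k3c1-p1 (g22; child-1 lineage); cure of the located «(s2)-JETS-COEFFNORM-KEYING».  Row 22 re-proved ONCE over the abstract jets
(section hypotheses `hjet`, `hjv : 4 ≤ v`, `hjκ : 4 ≤ κ`, each theorem taking exactly the ones it uses; see `…RungJetsV`): the DEEP CONDITION reads `v·|p_Q|_𝕋 ≤ A/2`
and the closed forms are those of `…RungJetsV`.  Instantiable by row 20 (`v = 4 + coeffNorm 1 K`) and by row 20′ `…BandJetsSup` (`v = 4 + 2A_K`, `κ = 4 + 8A_K`,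
`‖Dʲ(frameShift K)‖ ≤ A_K`, regime-native).  Statements and proofs are row 22's verbatim with the substitution; the jet-free lemmas `klrt_quarter_sq_le`,
`klrt_norm_propCT_le_one_div` are imported, not restated.  Everything is proved; no definitions; nothing asserts any slot, stub, K3 or SC. [folklore]
-/

noncomputable section

namespace Summit.HubbardSuperconductivity.HubbardSuperconductivity.Theorems.KLRegimeSplit

set_option linter.dupNamespace false -- summit = problem name (single-conjunct summit), D-0017

open Real Finset Literature.MathematicalPhysics.QuantumLattice Literature.Probability.LatticeModels
open Literature.MathematicalPhysics.QuantumLattice.FermiRG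
open Summit.HubbardSuperconductivity.HubbardSuperconductivity.Theorems.KLProgrammeLegKernels
open Summit.HubbardSuperconductivity.HubbardSuperconductivity.Theorems.TwoPointAssembly

/-! ## §1 The quarter lemma and the centre rung size -/

section Transport

variable {L M : ℕ} [NeZero L] (β μ : ℝ) (K : TrigPolyC4v)
variable {v κ : ℝ}
  (hjet : (∀ k Q : TorusSite 2 L, |nambuXiCT L μ K (k + Q) - nambuXiCT L μ K k| ≤ v * klTorusNorm L Q) ∧
    (∀ k Q : TorusSite 2 L, |nambuXiCT L μ K (k - Q) - nambuXiCT L μ K k| ≤ v * klTorusNorm L Q) ∧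
      ∀ k Q : TorusSite 2 L, |nambuXiCT L μ K (k + Q) - 2 * nambuXiCT L μ K k + nambuXiCT L μ K (k - Q)| ≤ κ * klTorusNorm L Q ^ 2)
  (hjv : 4 ≤ v) (hjκ : 4 ≤ κ)
include hjet hjv hjκ

/-! ## §2 Transport across a deep step -/

omit [NeZero L] hjv hjκ in
/-- **Rung sizes at the three points from the centre**: `0 < A`, `A² ≤ ω_ν² + e_K(p)²` and the deep condition `v·|p_Q|_𝕋 ≤ A/2` ⟹
`‖ĝ_K(ν,p+Q)‖ ≤ 2/A`, `‖ĝ_K(ν,p)‖ ≤ 2/A`, `‖ĝ_K(ν,p−Q)‖ ≤ 2/A`. [folklore] -/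
theorem klrtv_norm_propCT_three_le {A : ℝ} (hA : 0 < A) (ν : MatsubaraIdx M) (p Q : TorusSite 2 L)
    (h : A ^ 2 ≤ matsubaraFreq β M ν ^ 2 + nambuXiCT L μ K p ^ 2) (hdeep : v * klTorusNorm L Q ≤ A / 2) :
    ‖propCT L M β μ K (ν, p + Q)‖ ≤ 2 / A ∧ ‖propCT L M β μ K (ν, p)‖ ≤ 2 / A ∧ ‖propCT L M β μ K (ν, p - Q)‖ ≤ 2 / A := by
  have hA2 : 0 < A / 2 := by positivity
  have e2A : 1 / (A / 2) = 2 / A := by field_simp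
  have hp : (A / 2) ^ 2 ≤ matsubaraFreq β M ν ^ 2 + nambuXiCT L μ K (p + Q) ^ 2 :=
    klrt_quarter_sq_le hA.le h ((hjet.1 p Q).trans hdeep)
  have hm : (A / 2) ^ 2 ≤ matsubaraFreq β M ν ^ 2 + nambuXiCT L μ K (p - Q) ^ 2 :=
    klrt_quarter_sq_le hA.le h ((hjet.2.1 p Q).trans hdeep)
  refine ⟨?_, ?_, ?_⟩
  · rw [← e2A]; exact klrt_norm_propCT_le_one_div β μ K hA2 (ν, p + Q) hp
  · exact (klrt_norm_propCT_le_one_div β μ K hA (ν, p) h).trans (div_le_div_of_nonneg_right (by norm_num) hA.le)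
  · rw [← e2A]; exact klrt_norm_propCT_le_one_div β μ K hA2 (ν, p - Q) hm

omit [NeZero L] hjv hjκ in
/-- **Band sizes at the three points from the centre**: `|e_K(p)| ≤ E` and the deep condition ⟹ `|e_K(p′)| ≤ E + A/2` at `p′ = p−Q, p, p+Q`. [folklore] -/
theorem klrtv_abs_nambuXiCT_three_le {A E : ℝ} (hA : 0 ≤ A) (p Q : TorusSite 2 L) (hE : |nambuXiCT L μ K p| ≤ E)
    (hdeep : v * klTorusNorm L Q ≤ A / 2) :
    |nambuXiCT L μ K (p + Q)| ≤ E + A / 2 ∧ |nambuXiCT L μ K p| ≤ E + A / 2 ∧ |nambuXiCT L μ K (p - Q)| ≤ E + A / 2 := by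
  have hp := (hjet.1 p Q).trans hdeep
  have hm := (hjet.2.1 p Q).trans hdeep
  refine ⟨?_, by linarith, ?_⟩
  · have := abs_add_le (nambuXiCT L μ K (p + Q) - nambuXiCT L μ K p) (nambuXiCT L μ K p)
    rw [sub_add_cancel] at this; linarith
  · have := abs_add_le (nambuXiCT L μ K (p - Q) - nambuXiCT L μ K p) (nambuXiCT L μ K p)
    rw [sub_add_cancel] at this; linarith

/-! ## §3 The composed rows from centre data -/

omit [NeZero L] in
/-- **Second difference of the rung from centre data**: `0 < A`, `A² ≤ ω_ν² + e_K(p)²`, deep step ⟹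
`‖δ²_Q ĝ_K(ν,p)‖ ≤ (κ + 2v²·(2/A))·(2/A)²·|p_Q|_𝕋²`. [folklore] -/
theorem klrtv_norm_propCT_secondDiff_le_centre (hβ : β ≠ 0) {A : ℝ} (hA : 0 < A) (ν : MatsubaraIdx M) (p Q : TorusSite 2 L)
    (h : A ^ 2 ≤ matsubaraFreq β M ν ^ 2 + nambuXiCT L μ K p ^ 2) (hdeep : v * klTorusNorm L Q ≤ A / 2) :
    ‖propCT L M β μ K (ν, p + Q) - 2 * propCT L M β μ K (ν, p) + propCT L M β μ K (ν, p - Q)‖ ≤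
      (κ + 2 * v ^ 2 * (2 / A)) * (2 / A) ^ 2 * klTorusNorm L Q ^ 2 := by
  obtain ⟨gp, g0, gm⟩ := klrtv_norm_propCT_three_le β μ K hjet hA ν p Q h hdeep
  exact klrjv_norm_propCT_secondDiff_le_of_size β μ K hjet hjv hjκ hβ ν p Q gp g0 gm

omit [NeZero L] in
/-- **Second difference of the hard-shell weighted rung from centre data**: `0 < A`, `A² ≤ ω_ν² + e_K(p)²`, `|e_K(p)| ≤ E`, deep step ⟹
`‖δ²_Q(w_Λ·ĝ_K)(ν,p)‖ ≤ C(E + A/2, Λ, 2/A)·|p_Q|_𝕋²`, `C` the closed form of `klrjv_norm_cutoffWeightedRung_secondDiff_le`. [folklore] -/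
theorem klrtv_norm_cutoffWeightedRung_secondDiff_le_centre (hβ : β ≠ 0) (Λ : ℝ) {A E : ℝ} (hA : 0 < A) (ν : MatsubaraIdx M) (p Q : TorusSite 2 L)
    (h : A ^ 2 ≤ matsubaraFreq β M ν ^ 2 + nambuXiCT L μ K p ^ 2) (hE : |nambuXiCT L μ K p| ≤ E)
    (hdeep : v * klTorusNorm L Q ≤ A / 2) :
    ‖(hubbardCutoffWeightCT L M β μ K Λ (ν, p + Q) : ℂ) * propCT L M β μ K (ν, p + Q) -
          2 * ((hubbardCutoffWeightCT L M β μ K Λ (ν, p) : ℂ) * propCT L M β μ K (ν, p)) +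
        (hubbardCutoffWeightCT L M β μ K Λ (ν, p - Q) : ℂ) * propCT L M β μ K (ν, p - Q)‖ ≤
      ((16 / 3 * ((E + A / 2) * κ + v ^ 2) / Λ ^ 2 +
              1408 / 9 * (E + A / 2) ^ 2 * v ^ 2 / Λ ^ 4) * (2 / A) +
            2 * (8 / 3 * (v * (2 * (E + A / 2)) / Λ ^ 2)) * v * (2 / A) ^ 2 +
          (κ + 2 * v ^ 2 * (2 / A)) * (2 / A) ^ 2) *
        klTorusNorm L Q ^ 2 := by
  obtain ⟨gp, g0, gm⟩ := klrtv_norm_propCT_three_le β μ K hjet hA ν p Q h hdeep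
  obtain ⟨ep, e0, em⟩ := klrtv_abs_nambuXiCT_three_le μ K hjet hA.le p Q hE hdeep
  exact klrjv_norm_cutoffWeightedRung_secondDiff_le β μ K hjet hjv hjκ hβ Λ ν p Q gp g0 gm ep e0 em

/-- **Second difference of the complementary weighted rung from centre data**: the §5 twin (`φ = w_{Λ_m} − w_{Λ_n}`). [folklore] -/
theorem klrtv_norm_softWeightedRung_secondDiff_le_centre [NeZero M] (hβ : β ≠ 0) (n m : ℕ) {A E : ℝ} (hA : 0 < A) (ν : MatsubaraIdx M)
    (p Q : TorusSite 2 L) (h : A ^ 2 ≤ matsubaraFreq β M ν ^ 2 + nambuXiCT L μ K p ^ 2) (hE : |nambuXiCT L μ K p| ≤ E)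
    (hdeep : v * klTorusNorm L Q ≤ A / 2) :
    ‖(softSymbolCompl L M β μ K n m (ν, p + Q) : ℂ) * propCT L M β μ K (ν, p + Q) -
          2 * ((softSymbolCompl L M β μ K n m (ν, p) : ℂ) * propCT L M β μ K (ν, p)) +
        (softSymbolCompl L M β μ K n m (ν, p - Q) : ℂ) * propCT L M β μ K (ν, p - Q)‖ ≤
      (((16 / 3 * ((E + A / 2) * κ + v ^ 2) / klScale klE0 m ^ 2 +
              1408 / 9 * (E + A / 2) ^ 2 * v ^ 2 / klScale klE0 m ^ 4) +
            (16 / 3 * ((E + A / 2) * κ + v ^ 2) / klScale klE0 n ^ 2 +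
              1408 / 9 * (E + A / 2) ^ 2 * v ^ 2 / klScale klE0 n ^ 4)) * (2 / A) +
          2 * (8 / 3 * (v * (2 * (E + A / 2)) / klScale klE0 m ^ 2) +
              8 / 3 * (v * (2 * (E + A / 2)) / klScale klE0 n ^ 2)) * v * (2 / A) ^ 2 +
          (κ + 2 * v ^ 2 * (2 / A)) * (2 / A) ^ 2) * klTorusNorm L Q ^ 2 := by
  obtain ⟨gp, g0, gm⟩ := klrtv_norm_propCT_three_le β μ K hjet hA ν p Q h hdeep
  obtain ⟨ep, e0, em⟩ := klrtv_abs_nambuXiCT_three_le μ K hjet hA.le p Q hE hdeep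
  exact klrjv_norm_softWeightedRung_secondDiff_le β μ K hjet hjv hjκ hβ n m ν p Q gp g0 gm ep e0 em

end Transport

end Summit.HubbardSuperconductivity.HubbardSuperconductivity.Theorems.KLRegimeSplit

end

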